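import Literature.AlgebraicGeometry.HodgeTheory.WeilClassesProducts
import Literature.AlgebraicGeometry.HodgeTheory.WeilClassesFourfoldsProofs
import HarnessLib

/-!
# Markman §11.5 Step 2 on the carriers, assembled: sixfold statement (fact shape) ⇒ fourfold statement

Family `hodge`, layer `Literature/AlgebraicGeometry/HodgeTheory`. Sibling proof file of
`WeilClassesFourfolds` (the named fact `Markman2025_weilClasses_algebraic_abelianFourfold`),
`WeilClassesProducts` (Schoen's product step, upward half: the rational Weil projector) and
`WeilClassesFourfoldsProofs` (Schoen's transfer `pr_{A*}(z · (A × D))` relative to a Gysin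
formalism). No named fact is introduced and the fact is NOT discharged; this file COMPOSES the two
proved halves into the printed inference of E. Markman, arXiv:2509.23403 §11.5 Step 2 (arXiv v2 PDF p. 21, lines 40–49 = v1 p. 21, lines 20–29;
quoted from the held TeX-derived corpus chunk p0019 — not a PDF page — whose "[schoen]" the PDF prints as
"[S2, Prop. 10]"), verbatim: "The sixfold is hence of split type and so its Weil classes are algebraic. It
follows that the Weil classes of `(A₁,η₁,h₁)` are algebraic, by [schoen]." — [schoen] = C. Schoen,
Compositio Math. 114 (1998), §10 Proposition (held, pp. 332–333) — with the sixfold input in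
exactly the SHAPE OF THE NAMED FACT (every RATIONAL `(3,3)`-class of the Weil plane of the sixfold
is algebraic), which is the shape in which a vendored form of Markman's Thm. 1.5.1 would deliver it.

## Why two halves

`WeilClassesFourfoldsProofs.weilClassesOf_le_algebraicClasses_of_prod` takes as sixfold input the
algebraicity of `ξ ∪ pr₂^* η` for EVERY `ξ` in the complex Weil LINES `E±(A₁ × A₂)`; the named
fact's shape only speaks of rational `(n,n)`-classes of `E₊ ⊔ E₋`, and on the carriers neither
"`E±` is a line" nor "`E₊ ⊔ E₋` is defined over `ℚ`" is available (`H* = ⋀* H¹` is not). The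
bridge is `WeilClassesProducts.weilEigencomponents_cupProduct_mem_algebraicClasses`: for a RATIONAL
Weil class `c = c₊ + c₋` of `A₁` and a RATIONAL Weil class `w = u₊ + u₋` of `A₂`, the two
eigen-components `pr₁^*c± ∪ pr₂^*u±` of `pr₁^*c ∪ pr₂^*w` are `ℂ`-combinations of the rational Weil
classes `q(T)P`, `T q(T) P` of the sixfold (`T = (x·𝟙 + Φ)^*`, `q ∈ ℚ[X]`), hence algebraic as soon
as the rational `(3,3)` Weil classes of the sixfold are; Schoen's transfer
(`WeilClassesFourfoldsProofs.mem_algebraicClasses_of_gysin_fst_cupProduct`) then returns `c±`, hence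
`c`, algebraic on `A₁`.

## What is proved

`Markman2025_weilClasses_algebraic_abelianFourfold.pointwise_of_sixfold_partner`: for a complex
abelian fourfold `(A₁, φ₁)` and `d ≥ 1`, the conclusion of the named fact for `(A₁, φ₁, d)` — every
rational `(2,2)`-class of `weilClassesOf A₁ φ₁ 2 d` is algebraic — follows from the data of a
partner surface `(A₂, φ₂)` and a compatible endomorphism `Φ` of `A₁ × A₂` (e.g. `φ₁ × φ₂`,
`WeilClassesFourfoldsProofs.prodLift_comp_self_eq_neg_nsmul`) together with:
* (S6) the named fact's sixfold analogue for `(A₁ × A₂, Φ)` — Markman's theorem proper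
  (Thm. 1.5.1 / §11.5 Step 1, for the split sixfold);
* (V) `Nᵖ ∪ N^q ⊆ N^{p+q}` on `A₁ × A₂` in bidegree `(6, 2)` — Voisin II Prop. 9.20,
  "`cl(Z · Z') = cl(Z) ∪ cl(Z')`" (cf. `cupProduct_mem_algebraicClasses_of_moving`);
* (H) `pr₁^*`, `pr₂^*` and `∪` respect Hodge types on the sixfold — Voisin I §7.3.2, Thm. 5.29 (the
  layer's predicates `PreservesHodgeType`, `CupPreservesHodgeType`);
* (P) on the surface: a rational `(1,1)` Weil class `w = u₊ + u₋` (Schoen: "`W_{A'}` has Hodge type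
  `(1,1)`"), an algebraic `η ∈ H²(A₂(ℂ))` ("`W_{A'}` is generated by cohomology classes of
  divisors") and Schoen's two non-vanishing scalars `pr_{1*} pr₂^*(u± ∪ η) ≠ 0` (his computation
  with differential forms, "`ω_{5,σ₁} ∧ ω_{6,σ₁} ∧ ω_{5,σ₂} ∧ ω_{6,σ₂}` is a basis for `H⁴(A')`");
* (G) a Gysin formalism `G` (the layer's hypothesis structure for `f_*`).
Not here: the choice of `(A₂, φ₂)` making `A₁ × A₂` SPLIT (discriminant `-1`: Deligne–Milne,
van Geemen; no Riemann form on `H₁(A(ℂ), ℚ)` in the tree) and Thm. 1.5.1 itself.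

## References

* [Markman2025SurveySecant] E. Markman, Secant sheaves and Weil classes on abelian varieties,
  arXiv:2509.23403, §11.5 Step 2 (and Step 1, Thm. 1.2).
* [Markman2025SecantWeil] E. Markman, Cycles on abelian 2n-folds of Weil type from secant sheaves on
  abelian n-folds, arXiv:2502.03415, Thm. 1.5.1, Cor. 1.6.1 (proof).
* [Schoen1998HodgeWeilAddendum] C. Schoen, Addendum to: Hodge classes on self-products of a variety
  with an automorphism, Compositio Math. 114 (1998) 329–336, §10 (Proposition and proof).
* [VoisinHodgeII2003] C. Voisin, Hodge Theory and Complex Algebraic Geometry II, Prop. 9.20, 9.21.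
* [VoisinHodgeI2002] C. Voisin, Hodge Theory and Complex Algebraic Geometry I, §7.3.2, Thm. 5.29.
-/

noncomputable section

open CategoryTheory

namespace Literature.AlgebraicGeometry.HodgeTheory

open Literature.AlgebraicTopology.SingularHomology

section HodgeTheory

variable (G : GysinFormalism) {A₁ A₂ : Motives.AbelianVariety ℂ}

/-- **Markman §11.5 Step 2 for `(A₁, φ₁)`, from the sixfold statement in the shape of the named
fact.** Let `(A₁, φ₁)` be a complex abelian fourfold with an endomorphism, `d ≥ 1`, `(A₂, φ₂)` a
complex abelian surface with an endomorphism and `Φ` an endomorphism of `A₁ × A₂` over both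
(`Φ ≫ prᵢ = prᵢ ≫ φᵢ`; e.g. `φ₁ × φ₂`). Assume: (S6) every rational class of Hodge type `(3,3)` in
the Weil plane `weilClassesOf (A₁ × A₂) Φ 3 d` is algebraic ("The sixfold is hence of split type and
so its Weil classes are algebraic"); (V) cup products of algebraic classes of codimensions `3` and
`1` on `A₁ × A₂` are algebraic (Voisin II Prop. 9.20); (H) `pr₁^*`, `pr₂^*`, `∪` respect Hodge types
on the sixfold; (P) `w = u₊ + u₋` is a RATIONAL `(1,1)`-class of `A₂` with `u₊ ∈ E₊(A₂, φ₂)`,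
`u₋ ∈ E₋(A₂, φ₂)`, `η ∈ H²(A₂(ℂ))` is algebraic, and the transfer scalars
`pr_{1*} pr₂^*(u± ∪ η) ∈ H⁰(A₁(ℂ))` are non-zero (Schoen's surjectivity); (G) `G` is a Gysin
formalism. THEN every rational `(2,2)`-class `c` of the Weil plane of `(A₁, φ₁)` in degree `4` is
algebraic — "It follows that the Weil classes of `(A₁,η₁,h₁)` are algebraic, by [schoen]". Proof:
`c = c₊ + c₋`; by `weilEigencomponents_of_sixfold` (rational projector, file `WeilClassesProducts`)
both `pr₁^*c± ∪ pr₂^*u±` are algebraic on the sixfold; by (V) so are their products with `pr₂^*η`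
(`pr₂^*η` algebraic: flat pull-back, `map_snd_mem_supportedClasses`); Schoen's transfer
`mem_algebraicClasses_of_gysin_fst_cupProduct` (file `WeilClassesFourfoldsProofs`) gives `c±`
algebraic. [cite: Markman2025SurveySecant, §11.5 Step 2]
[cite: Schoen1998HodgeWeilAddendum, §10 (Proposition and proof, pp. 332–333)]
[cite: Markman2025SecantWeil, Cor. 1.6.1 (proof)] [cite: VoisinHodgeII2003, Prop. 9.20] -/
theorem Markman2025_weilClasses_algebraic_abelianFourfold.pointwise_of_sixfold_partner {d : ℕ}
    (hd : 0 < d) {φ₁ : A₁ ⟶ A₁} {φ₂ : A₂ ⟶ A₂} {Φ : A₁.prod A₂ ⟶ A₁.prod A₂}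
    (hA₁ : Motives.IsSmoothProjective (2 * 2) A₁.X) (hA₂ : Motives.IsSmoothProjective (2 * 1) A₂.X)
    (h₁ : Φ ≫ Motives.AbelianVariety.fst A₁ A₂ = Motives.AbelianVariety.fst A₁ A₂ ≫ φ₁)
    (h₂ : Φ ≫ Motives.AbelianVariety.snd A₁ A₂ = Motives.AbelianVariety.snd A₁ A₂ ≫ φ₂)
    (hB : ∀ c : complexBetti (A₁.prod A₂).X (2 * 3), IsRationalClass c →
      IsOfHodgeType (2 * 3) (A₁.prod A₂).X (2 * 3) 3 3 c → c ∈ weilClassesOf (A₁.prod A₂) Φ 3 d →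
        c ∈ algebraicClasses (A₁.prod A₂).X 3)
    (hcup : ∀ ⦃a : complexBetti (A₁.prod A₂).X (2 * 3)⦄ ⦃b : complexBetti (A₁.prod A₂).X (2 * 1)⦄,
      a ∈ algebraicClasses (A₁.prod A₂).X 3 → b ∈ algebraicClasses (A₁.prod A₂).X 1 →
        cupProduct (show 2 * 3 + 2 * 1 = 2 * (2 + 2 * 1) by rfl) a b ∈
          algebraicClasses (A₁.prod A₂).X (2 + 2 * 1))
    (hfst : PreservesHodgeType (2 * 3) (2 * 2) (Motives.AbelianVariety.fst A₁ A₂).hom.hom.hom)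
    (hsnd : PreservesHodgeType (2 * 3) (2 * 1) (Motives.AbelianVariety.snd A₁ A₂).hom.hom.hom)
    (hcupH : CupPreservesHodgeType (2 * 3) (A₁.prod A₂).X)
    {up um η : complexBetti A₂.X (2 * 1)} (hup : up ∈ weilClassesPlus A₂ φ₂ 1 d)
    (hum : um ∈ weilClassesMinus A₂ φ₂ 1 d) (hr₂ : IsRationalClass (up + um))
    (hw₂ : IsOfHodgeType (2 * 1) A₂.X (2 * 1) 1 1 (up + um)) (hη : η ∈ algebraicClasses A₂.X 1)
    (hnep : G.gysin (isSmoothProjective_prod hA₁ hA₂) hA₁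
        (Motives.AbelianVariety.fst A₁ A₂).hom.hom.hom
        (show 2 * (2 * 1) + 2 * (2 * 2) = 0 + 2 * (2 * 2 + 2 * 1) by omega)
        (complexBetti.map (Motives.AbelianVariety.snd A₁ A₂).hom.hom.hom (2 * (2 * 1))
          (cupProduct (show 2 * 1 + 2 * 1 = 2 * (2 * 1) by omega) up η)) ≠ 0)
    (hnem : G.gysin (isSmoothProjective_prod hA₁ hA₂) hA₁
        (Motives.AbelianVariety.fst A₁ A₂).hom.hom.hom
        (show 2 * (2 * 1) + 2 * (2 * 2) = 0 + 2 * (2 * 2 + 2 * 1) by omega)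
        (complexBetti.map (Motives.AbelianVariety.snd A₁ A₂).hom.hom.hom (2 * (2 * 1))
          (cupProduct (show 2 * 1 + 2 * 1 = 2 * (2 * 1) by omega) um η)) ≠ 0) :
    ∀ c : singularCohomology ℂ ℂ (Motives.ComplexPoints A₁.X) (2 * 2), IsRationalClass c →
      IsOfHodgeType (2 * 2) A₁.X (2 * 2) 2 2 c → c ∈ weilClassesOf A₁ φ₁ 2 d →
        c ∈ algebraicClasses A₁.X 2 := by
  intro c hc hcH hcW
  rw [weilClassesOf, Submodule.mem_sup] at hcW
  obtain ⟨cp, hcp, cm, hcm, rfl⟩ := hcW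
  have hBX : Motives.IsSmoothProjective (2 * 3) (A₁.prod A₂).X := isSmoothProjective_prod hA₁ hA₂
  -- the two eigen-components of `pr₁^* c ∪ pr₂^* w` are algebraic on the sixfold
  obtain ⟨hP, hM⟩ :=
    Markman2025_weilClasses_algebraic_abelianFourfold.weilEigencomponents_of_sixfold hd h₁.symm
      h₂.symm hBX hB hfst hsnd hcupH hcp hcm hup hum hc hcH hr₂ hw₂
  -- `pr₂^* η` is algebraic (flat pull-back)
  have hη' : complexBetti.map (Motives.AbelianVariety.snd A₁ A₂).hom.hom.hom (2 * 1) η ∈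
      algebraicClasses (A₁.prod A₂).X 1 :=
    map_snd_mem_supportedClasses hA₁ hA₂ hη
  -- Schoen's transfer, component by component
  refine Submodule.add_mem _ ?_ ?_
  · exact mem_algebraicClasses_of_gysin_fst_cupProduct G hA₁ hA₂ (l := 2) (j := 2 * 1) (j' := 2 * 1)
      (s := 2 * 3) (show 2 * 2 + 2 * 1 = 2 * 3 by rfl) (show 2 * 1 + 2 * 1 = 2 * (2 * 1) by omega)
      hnep (hcup hP hη')
  · exact mem_algebraicClasses_of_gysin_fst_cupProduct G hA₁ hA₂ (l := 2) (j := 2 * 1) (j' := 2 * 1)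
      (s := 2 * 3) (show 2 * 2 + 2 * 1 = 2 * 3 by rfl) (show 2 * 1 + 2 * 1 = 2 * (2 * 1) by omega)
      hnem (hcup hM hη')

end HodgeTheory

end Literature.AlgebraicGeometry.HodgeTheory

end
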